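import Summits.BirchSwinnertonDyer.Rank1Residual.X11b.BDPRouteWholeClassLarge
import Summits.BirchSwinnertonDyer.Rank1Residual.X11b.AnticyclotomicLowerLinksHeegner
import HarnessLib

/-!
# Class X11b, route "BDP + converse-theorem engine + Kolyvagin": STEP L read through the TREE-OBJECT links — the datum and the class theorem with (T1ᵗ) (cell `b2b-bsdres`, sub-cell `multr1-p2`, gen 11)

HONEST FRAMING (verbatim, cell `b2b-bsdres`): the goal of the cell is to DELETE the
COMBINATION-SHAPED residual classes for ALL analytic-rank `≤ 1` curves over `ℚ` — "full BSD
formula for every rank `≤ 1` curve in class `C`" assembled STRICTLY from published theorems — so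
that the rank-`≤ 1` remainder becomes exactly the CONSTRUCTION-SHAPED classes, which are TYPED
(missing-input Props), NOT attempted; this is not "finishing BSD". Research route `p2` for class
X11b; no claim beyond the stated class; nothing booked; X11b stays CONSTRUCTION-SHAPED. THEOREMS
ONLY (no definition, no named fact); continuation of `BDPRouteWholeClassLarge.lean` over the sibling
sub-cell's `AnticyclotomicLowerLinksHeegner.lean` (multr1-p1, gen 8); the end form with (T2♯-ℝ) is
`BDPRouteWholeClassOnTree.lean`.

## Content

The typed input (T1) = STEP L of the route (`IndexLowerBoundAt W p K P`:
`2·ord_p[E(K):ℤP_K] ≤ ord_p #Ш(E/K) + 2·ord_p ∏_ℓ c_ℓ(E)`, JSW17 §7.4.1 (eq:shalowerK-1)) was so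
far a binder `hL` about the predicate `IndexLowerBoundAt`. The sibling sub-cell constructed the
objects behind it — the anticyclotomic Selmer dual `X_ac(E[p^∞])` over `Λ` (`AcSelmer.XAc`), its
characteristic valuation (`XAc.HasCharValuationAt`), THE completion embedding `embAt K p 𝔭 : K ↪ ℚ_p`
at a degree-one prime, `ord_p log_{ω_E} P` (`padicLogOrd`), `∏_{w∣N⁺} c_w(E/K)`
(`tamagawaProductSplit`) — and proved `indexLowerBoundAt_of_onTreeLowerLinks_of_heegner`: at a
classical Heegner field, `Ш(E/K)` finite, the two links
* (CTL)ᵗ `ControlOnTreeAt p κ 𝔭 γ ι P` — Castella 2018 Thm. 2.3 (⇐ JSW17 Thm. 3.3.1) on the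
  constructed `X_ac`: `#ℤ_p/f_ac(0) = #Ш(E/K)[p^∞] · (#ℤ_p/((1 − a_p p⁻¹)·log_{ω_E} P)/[E(K)⊗ℤ_p : ℤ_p·P])²
  · ∏_{w∣N⁺} c_w^{(p)}(E/K)`, i.e. `ord_p f_ac(0) = ord_p #Ш(E/K)[p^∞] + 2·((ord_p log_ω P − 1) −
  ord_p[E(K):ℤP]) + ord_p ∏_{w∣N⁺} c_w` (`a_p = ±1`) — PUBLISHED SHAPE, every symbol a tree object;
* (IMC≥∘BDP)ᵗ `IMCLowerWaldspurgerOnTreeAt p κ 𝔭 γ ι P` — the one-sided divisibility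
  "`Ch_Λ(X_ac) ⊆ (L_p(f))`" at the trivial character composed with Cas18 Thm. 3.2 (BDP at `p ∣ N`):
  `2·(ord_p log_ω P − 1) ≤ ord_p f_ac(0)` — OPEN at `p ∥ N` (erratum (2.4) "By [FW21, Thm. 4.41]",
  UNREFEREED) ∘ PUB, every symbol a tree object;
give `IndexLowerBoundAt W p K P`.

This file closes the remaining bookkeeping INSIDE the kernel and re-issues the class theorems:

* `not_isOfFinAddOrder_of_heegner_of_analyticRank_eq_one`, `finite_sha_baseChange_of_heegner` —
  at the route's data (`r_an(E) = 1`, `L(E^{d_K},1) ≠ 0`, `P` the Heegner point) the Heegner point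
  is non-torsion and `Ш(E/K)` is finite: Gross–Zagier (`hGZ`) + Kolyvagin (`hKo`) + modularity
  (`L(E/K,s) = L(E,s)L(E^{d_K},s)`), as in `BDPRouteShaAn`.
* `indexLowerBoundAt_of_heegner_of_onTreeLowerLinks` — STEP L at the datum from the two tree-object
  links at ONE `(κ, γ, 𝔭, ι)`, finiteness discharged.
* `indexLowerBoundAt_of_heegner_of_onTreeInputs` — the same from the links in route R1's idiom
  (for EVERY anticyclotomic `ℤ_p`-extension `κ`, generator `γ`, degree-one `𝔭 ∋ p`, with THE
  embedding `embAt`): an anticyclotomic `κ`, a generator and a prime above `p` exist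
  (`exists_anticyclotomic_generator_prime`), and `𝔭` has degree one because `p ∣ N_E` splits in a
  Heegner field (`degreeOne_of_splitsIn`).
* `missingLowerBoundAt_of_classX11b_of_surj_of_onTreeInputs` — the main-conjecture half
  `ord_p #Ш(E)_an ≤ ord_p #Ш(E)` on X11b ∧ surj(p) ∧ `p ≥ 5` from (CTL)ᵗ + (IMC≥∘BDP)ᵗ demanded ONLY at
  the odd-`d_K` Manin-good Heegner data of such pairs (Hoffstein–Luo supply), in place of `hL`.
* `bsdp_of_classX11b_five_of_onTreeInputs_local` — gen 7/x11c's `…_typedInputs_local` with (T1)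
  replaced by (T1ᵗ) = (CTL)ᵗ [PUB shape] + (IMC≥∘BDP)ᵗ [OPEN].
* (`BDPRouteWholeClassOnTree.lean`: the end form `bsdp_of_classX11b_five_of_onTreeInputs_shimuraGZR`
  with (T2α′) + (T2♯-ℝ) in place of (T2).)

CONDITIONAL; nothing booked; reach and labels unchanged; X11b stays CONSTRUCTION-SHAPED.

References: [JetchevSkinnerWan2017] §7.4.1 (eq:shalowerK-1), §7.3.1 (eq:tamK) (arXiv:1512.06894
p. 30), Thm. 3.3.1; [Castella2018] (1.1), Thm. 2.3 (arXiv:1704.06608 p. 5), Thm. 3.2 (p. 9), §5;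
[Castella2018Erratum] (2.4), Thm. 1.1; [Gross1991] (1.1), Thm. 1.3; [Kolyvagin1990] Thm. A; the
references of `BDPRouteWholeClassLarge.lean`.
-/

noncomputable section

open scoped Classical

open WeierstrassCurve NumberField IsDedekindDomain Literature.NumberTheory.EllipticCurves
  Literature.NumberTheory.EllipticCurves.ModularForms
  Literature.NumberTheory.EllipticCurves.Rank1Residual
  Literature.NumberTheory.EllipticCurves.Rank1Residual.Typed
  Literature.NumberTheory.EllipticCurves.Wuthrich2014
  Literature.NumberTheory.EllipticCurves.BalakrishnanEtAl2019
  Literature.NumberTheory.QuadraticFields.Quadratic Literature.NumberTheory.EllipticCurves.KrizLi2019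
  Summit.BirchSwinnertonDyer.Rank1Residual.X11b.AcSelmer

namespace Summit.BirchSwinnertonDyer.Rank1Residual.X11b

/-! ### The datum: non-torsion Heegner point, finite `Ш(E/K)`, STEP L from the tree-object links -/

section Datum

variable (W : WeierstrassCurve ℚ) [W.IsElliptic] [W.IsGloballyMinimal] (p : ℕ) [Fact p.Prime]
  (N : ℕ) [NeZero N] (K : Type) [Field K] [NumberField K]
  (Dt : ModularParametrizationData W N) (H : HeegnerDatum N (NumberField.discr K)) (ι : K →+* ℂ)
  (P : (W.baseChange K).toAffine.Point)

omit [Fact p.Prime] [W.IsGloballyMinimal] in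
/-- **The Heegner point is non-torsion** at the route's data: `ord_{s=1} L(E,s) = 1` and
`L(E^{d_K},1) ≠ 0` give `L′(E/K,1) = L′(E,1)·L(E^{d_K},1) ≠ 0` (modularity, `hmod`), hence
`ĥ(P_K) ≠ 0` by Gross–Zagier (`hGZ`). [cite: Gross1991, (1.1)] [cite: GrossZagier1986, Thm. I.(6.3)] -/
theorem not_isOfFinAddOrder_of_heegner_of_analyticRank_eq_one
    (hGZ : gross_zagier N W K) (hmod : hasEntireLFunction_rat)
    (hr : W.analyticRank = 1) (hK : IsImaginaryQuadratic K) (hHN : SatisfiesHeegnerHypothesis N K)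
    (hLt : (W.quadraticTwist (NumberField.discr K : ℚ)).entireLFunction 1 ≠ 0)
    (hP : WeierstrassCurve.Affine.Point.map ι.toRatAlgHom P = heegnerPointComplex Dt H) :
    ¬ IsOfFinAddOrder P := by
  have hL0 : W.entireLFunction 1 = 0 := entireLFunction_one_eq_zero_of_analyticRank_eq_one hr
  obtain ⟨-, hderiv⟩ := leadingLCoeff_eq_deriv_of_analyticRank_eq_one hr
  have hLK : LDerivEK W K ≠ 0 := by
    rw [lDerivEK_eq_deriv_mul W K hmod hL0]
    exact mul_ne_zero hderiv hLt
  exact (lDerivEK_ne_zero_iff_not_isOfFinAddOrder W N K hGZ hK hHN ⟨Dt, H, ι, hP⟩).mp hLK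

omit [Fact p.Prime] [W.IsGloballyMinimal] in
/-- **`Ш(E/K)` is finite** at the route's data: the Heegner point is non-torsion
(`not_isOfFinAddOrder_of_heegner_of_analyticRank_eq_one`), then Kolyvagin (`hKo`).
[cite: Kolyvagin1990, Thm. A] [cite: Gross1991, Thm. 1.3] -/
theorem finite_sha_baseChange_of_heegner
    (hGZ : gross_zagier N W K) (hKo : kolyvagin N W K) (hmod : hasEntireLFunction_rat)
    (hr : W.analyticRank = 1) (hK : IsImaginaryQuadratic K) (hHN : SatisfiesHeegnerHypothesis N K)
    (hLt : (W.quadraticTwist (NumberField.discr K : ℚ)).entireLFunction 1 ≠ 0)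
    (hP : WeierstrassCurve.Affine.Point.map ι.toRatAlgHom P = heegnerPointComplex Dt H) :
    Finite (W.baseChange K).sha :=
  (hKo hK hHN ⟨Dt, H, ι, hP⟩
    (not_isOfFinAddOrder_of_heegner_of_analyticRank_eq_one W N K Dt H ι P hGZ hmod hr hK hHN hLt
      hP)).2

/-- **STEP L at a classical Heegner datum from the two TREE-OBJECT links at one `(κ, γ, 𝔭, ι)`,
finiteness of `Ш(E/K)` discharged** (Gross–Zagier + Kolyvagin): for `p ≥ 5`, `ord_{s=1} L(E,s) = 1`,
`K` imaginary quadratic with the Heegner hypothesis for `N = N_E` and `L(E^{d_K},1) ≠ 0`, `P` the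
Heegner point of `(Dt, H, ι)`, the OPEN (IMC≥∘BDP)ᵗ and the PUB-shaped (CTL)ᵗ give
`IndexLowerBoundAt W p K P` — the sibling's `indexLowerBoundAt_of_onTreeLowerLinks_of_heegner` with
its `[Finite Ш(E/K)]` supplied by `finite_sha_baseChange_of_heegner`. CONDITIONAL on the open link.
[cite: JetchevSkinnerWan2017, §7.4.1 (eq:shalowerK-1) and §7.3.1 (eq:tamK) (arXiv:1512.06894 p. 30)]
[cite: Castella2018, (1.1) (p. 2), Thm. 2.3 (p. 5), Thm. 3.2 (p. 9)] [cite: Kolyvagin1990, Thm. A] -/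
theorem indexLowerBoundAt_of_heegner_of_onTreeLowerLinks
    (hGZ : gross_zagier N W K) (hKo : kolyvagin N W K) (hmod : hasEntireLFunction_rat)
    (hp : 5 ≤ p) (hr : W.analyticRank = 1) (hN : W.conductorNorm ℤ = N) (hK : IsImaginaryQuadratic K)
    (hHN : SatisfiesHeegnerHypothesis N K)
    (hLt : (W.quadraticTwist (NumberField.discr K : ℚ)).entireLFunction 1 ≠ 0)
    (hP : WeierstrassCurve.Affine.Point.map ι.toRatAlgHom P = heegnerPointComplex Dt H)
    {κ : ZpExtension K p} {𝔭 : HeightOneSpectrum (𝓞 K)} {γ : Field.absoluteGaloisGroup K}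
    [Fact (κ.IsTopGenerator γ)] {ιp : K →+* ℚ_[p]}
    (hIW : IMCLowerWaldspurgerOnTreeAt p κ 𝔭 γ ιp P) (hCTL : ControlOnTreeAt p κ 𝔭 γ ιp P) :
    IndexLowerBoundAt W p K P := by
  haveI : Finite (W.baseChange K).sha :=
    finite_sha_baseChange_of_heegner W N K Dt H ι P hGZ hKo hmod hr hK hHN hLt hP
  exact indexLowerBoundAt_of_onTreeLowerLinks_of_heegner hp hK hN hHN hIW hCTL

/-- **STEP L at a classical Heegner datum from the tree-object links in route R1's idiom** — the
links demanded for EVERY anticyclotomic `ℤ_p`-extension `κ` of `K`, topological generator `γ` and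
degree-one prime `𝔭 ∋ p` of `𝓞_K`, with THE embedding `embAt K p 𝔭 : K ↪ K_𝔭 = ℚ_p` (the binders of
`R1ControlOnTreeAt` / `R1OpenInputOnTreeAt`). An anticyclotomic `κ`, a generator and a prime above
`p` exist (`exists_anticyclotomic_generator_prime`: global reciprocity); the prime has degree one
because `p ∣ N_E` (`p` multiplicative) splits in the Heegner field. CONDITIONAL on the open link.
[cite: JetchevSkinnerWan2017, §7.4.1 (eq:shalowerK-1) (arXiv:1512.06894 p. 30)]
[cite: Castella2018, Thm. 2.3 (p. 5), Thm. 3.2 (p. 9)] [cite: Castella2018Erratum, Thm. 1.1 (p. 1)] -/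
theorem indexLowerBoundAt_of_heegner_of_onTreeInputs
    (hGZ : gross_zagier N W K) (hKo : kolyvagin N W K) (hmod : hasEntireLFunction_rat)
    (hp : 5 ≤ p) (hr : W.analyticRank = 1) (hmult : Mult W p) (hN : W.conductorNorm ℤ = N)
    (hK : IsImaginaryQuadratic K) (hHN : SatisfiesHeegnerHypothesis N K)
    (hLt : (W.quadraticTwist (NumberField.discr K : ℚ)).entireLFunction 1 ≠ 0)
    (hP : WeierstrassCurve.Affine.Point.map ι.toRatAlgHom P = heegnerPointComplex Dt H)
    (hC : ∀ (κ : ZpExtension K p), κ.IsAnticyclotomic →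
      ∀ (γ : Field.absoluteGaloisGroup K) [Fact (κ.IsTopGenerator γ)] (𝔭 : HeightOneSpectrum (𝓞 K))
        (h𝔭 : ((p : ℕ) : 𝓞 K) ∈ 𝔭.asIdeal) (he : 𝔭.asIdeal.ramificationIdx (𝓞 ℚ) = 1)
        (hf : 𝔭.asIdeal.inertiaDeg (𝓞 ℚ) = 1),
        ControlOnTreeAt p κ 𝔭 γ (embAt K p 𝔭 h𝔭 he hf) P)
    (hA : ∀ (κ : ZpExtension K p), κ.IsAnticyclotomic →
      ∀ (γ : Field.absoluteGaloisGroup K) [Fact (κ.IsTopGenerator γ)] (𝔭 : HeightOneSpectrum (𝓞 K))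
        (h𝔭 : ((p : ℕ) : 𝓞 K) ∈ 𝔭.asIdeal) (he : 𝔭.asIdeal.ramificationIdx (𝓞 ℚ) = 1)
        (hf : 𝔭.asIdeal.inertiaDeg (𝓞 ℚ) = 1),
        IMCLowerWaldspurgerOnTreeAt p κ 𝔭 γ (embAt K p 𝔭 h𝔭 he hf) P) :
    IndexLowerBoundAt W p K P := by
  have hpN : p ∣ N := hN ▸ dvd_conductorNorm_of_mult hmult
  have hsplit : SplitsIn K p := hHN p Fact.out hpN
  obtain ⟨κ, γ, 𝔭, hκ, hγ, h𝔭⟩ := exists_anticyclotomic_generator_prime (p := p) hK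
  haveI : Fact (κ.IsTopGenerator γ) := ⟨hγ⟩
  obtain ⟨he, hf⟩ := degreeOne_of_splitsIn hK.1 hsplit h𝔭
  exact indexLowerBoundAt_of_heegner_of_onTreeLowerLinks W p N K Dt H ι P hGZ hKo hmod hp hr hN hK
    hHN hLt hP (hA κ hκ γ 𝔭 h𝔭 he hf) (hC κ hκ γ 𝔭 h𝔭 he hf)

end Datum

/-! ### Class level: (T1) replaced by the tree-object links (T1ᵗ) = (CTL)ᵗ [PUB shape] + (IMC≥∘BDP)ᵗ [OPEN] -/

/-- **The main-conjecture half `ord_p #Ш(E)_an ≤ ord_p #Ш(E)` on X11b ∧ surj(p) ∧ `p ≥ 5` from the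
TREE-OBJECT links.** As `missingLowerBoundAt_of_classX11b_of_surj_odd` (Wuthrich Prop. 21 for the
twist, Hoffstein–Luo supply of odd-`d_K` Manin-good Heegner data, Gross–Zagier bookkeeping) with its
binder `hL` (STEP L as a predicate) REPLACED by the two links on constructed objects, demanded only
at those data and only at non-torsion Heegner points: `hLC` = (CTL)ᵗ `ControlOnTreeAt` (Cas18
Thm. 2.3, PUB shape) and `hLA` = (IMC≥∘BDP)ᵗ `IMCLowerWaldspurgerOnTreeAt` (OPEN ∘ PUB), for every
anticyclotomic `κ`, generator `γ`, degree-one `𝔭`, with `embAt`. CONDITIONAL on `hLA`; nothing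
booked. [cite: Wuthrich2014, Prop. 21 (p. 400)] [cite: JetchevSkinnerWan2017, §7.4.1 (pp. 30–31)]
[cite: Castella2018, Thm. 2.3 (p. 5), Thm. 3.2 (p. 9)] [cite: Mazur1978, Cor. 4.1] [cite: Miller2011LMS, Def. 1.1] -/
theorem missingLowerBoundAt_of_classX11b_of_surj_of_onTreeInputs
    -- published inputs (named facts of the tree)
    (hGZ : ∀ (N : ℕ) [NeZero N] (W : WeierstrassCurve ℚ) (K : Type) [Field K] [NumberField K],
      gross_zagier N W K)
    (hKo : ∀ (N : ℕ) [NeZero N] (W : WeierstrassCurve ℚ) (K : Type) [Field K] [NumberField K],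
      kolyvagin N W K)
    (hWu : sha_dvd_analyticSha)
    (hGZK : rank_eq_analyticRank_of_analyticRank_le_one) (hmod : hasEntireLFunction_rat)
    (hnf : exists_isNewformOf) (hHL : HoffsteinLuo1997_exists_twist_L_one_ne_zero)
    (hMaz : mazur_not_dvd_maninConstant_of_odd) (hNS : integral_neronScaling_of_isGloballyMinimal)
    -- (T1ᵗ-CTL) the control link on the constructed `X_ac` — PUB shape (Cas18 Thm. 2.3)
    (hLC : ∀ (W : WeierstrassCurve ℚ) [W.IsElliptic] [W.IsGloballyMinimal] (p : ℕ) [Fact p.Prime]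
      (N : ℕ) [NeZero N] (K : Type) [Field K] [NumberField K]
      (Dt : ModularParametrizationData W N) (H : HeegnerDatum N (NumberField.discr K)) (ι : K →+* ℂ)
      (P : (W.baseChange K).toAffine.Point),
      ClassX11b W p → 5 ≤ p → Surj W p → W.conductorNorm ℤ = N → IsImaginaryQuadratic K →
      Odd (NumberField.discr K) → ¬ (p : ℤ) ∣ NumberField.discr K → ¬ p ∣ Units.torsionOrder K →
      SatisfiesHeegnerHypothesis N K →
      (W.quadraticTwist (NumberField.discr K : ℚ)).entireLFunction 1 ≠ 0 →
      WeierstrassCurve.Affine.Point.map ι.toRatAlgHom P = heegnerPointComplex Dt H →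
      ¬ (p : ℤ) ∣ Dt.c → ¬ IsOfFinAddOrder P →
      ∀ (κ : ZpExtension K p), κ.IsAnticyclotomic →
        ∀ (γ : Field.absoluteGaloisGroup K) [Fact (κ.IsTopGenerator γ)]
          (𝔭 : HeightOneSpectrum (𝓞 K)) (h𝔭 : ((p : ℕ) : 𝓞 K) ∈ 𝔭.asIdeal)
          (he : 𝔭.asIdeal.ramificationIdx (𝓞 ℚ) = 1) (hf : 𝔭.asIdeal.inertiaDeg (𝓞 ℚ) = 1),
          ControlOnTreeAt p κ 𝔭 γ (embAt K p 𝔭 h𝔭 he hf) P)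
    -- (T1ᵗ-IMC) the one-sided main-conjecture link composed with BDP, on constructed objects — OPEN
    (hLA : ∀ (W : WeierstrassCurve ℚ) [W.IsElliptic] [W.IsGloballyMinimal] (p : ℕ) [Fact p.Prime]
      (N : ℕ) [NeZero N] (K : Type) [Field K] [NumberField K]
      (Dt : ModularParametrizationData W N) (H : HeegnerDatum N (NumberField.discr K)) (ι : K →+* ℂ)
      (P : (W.baseChange K).toAffine.Point),
      ClassX11b W p → 5 ≤ p → Surj W p → W.conductorNorm ℤ = N → IsImaginaryQuadratic K →
      Odd (NumberField.discr K) → ¬ (p : ℤ) ∣ NumberField.discr K → ¬ p ∣ Units.torsionOrder K →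
      SatisfiesHeegnerHypothesis N K →
      (W.quadraticTwist (NumberField.discr K : ℚ)).entireLFunction 1 ≠ 0 →
      WeierstrassCurve.Affine.Point.map ι.toRatAlgHom P = heegnerPointComplex Dt H →
      ¬ (p : ℤ) ∣ Dt.c → ¬ IsOfFinAddOrder P →
      ∀ (κ : ZpExtension K p), κ.IsAnticyclotomic →
        ∀ (γ : Field.absoluteGaloisGroup K) [Fact (κ.IsTopGenerator γ)]
          (𝔭 : HeightOneSpectrum (𝓞 K)) (h𝔭 : ((p : ℕ) : 𝓞 K) ∈ 𝔭.asIdeal)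
          (he : 𝔭.asIdeal.ramificationIdx (𝓞 ℚ) = 1) (hf : 𝔭.asIdeal.inertiaDeg (𝓞 ℚ) = 1),
          IMCLowerWaldspurgerOnTreeAt p κ 𝔭 γ (embAt K p 𝔭 h𝔭 he hf) P) :
    ∀ (W : WeierstrassCurve ℚ) [W.IsElliptic] [W.IsGloballyMinimal] (p : ℕ) [Fact p.Prime],
      ClassX11b W p → 5 ≤ p → Surj W p → Typed.MissingLowerBoundAt W p := by
  intro W _ _ p _ hX hp5 hsurj
  have hX' := hX
  obtain ⟨hr, hp2, hmult, hirr⟩ := hX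
  haveI : NeZero (W.conductorNorm ℤ) := ⟨(W.conductorNorm_pos_holds).ne'⟩
  obtain ⟨K, _, _, Dt, H, ι, P, Wd, _, _, Cd, hK, hodd, hpd, hHN, hP, hc, hμ, hLt, hWd⟩ :=
    exists_oddHeegnerData hnf hHL hMaz hNS W p hr hp2 hmult hirr
  have hPinf : ¬ IsOfFinAddOrder P :=
    not_isOfFinAddOrder_of_heegner_of_analyticRank_eq_one W _ K Dt H ι P (hGZ _ W K) hmod hr hK hHN
      hLt hP
  exact missingLowerBoundAt_of_indexLowerBoundAt_of_surj_odd W p K Dt H ι P (hGZ _ W K) (hKo _ W K)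
    hWu hGZK hmod hr hp2 hmult hsurj hK hodd hpd hHN hP hc hμ hLt Wd Cd hWd
    (indexLowerBoundAt_of_heegner_of_onTreeInputs W p _ K Dt H ι P (hGZ _ W K) (hKo _ W K) hmod hp5
      hr hmult rfl hK hHN hLt hP
      (hLC W p _ K Dt H ι P hX' hp5 hsurj rfl hK hodd hpd hμ hHN hLt hP hc hPinf)
      (hLA W p _ K Dt H ι P hX' hp5 hsurj rfl hK hodd hpd hμ hHN hLt hP hc hPinf))

/-- **X11b, whole class, `p ≥ 5`, (T1) read through the TREE-OBJECT links, (T4) localised.**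
`BSD(E,p)` for EVERY pair `(E,p)` of X11b with `p ≥ 5`, from the published facts (+ `hBDMTV`) and
the typed inputs (T1ᵗ) = (CTL)ᵗ `hLC` [Cas18 Thm. 2.3 on the constructed `X_ac`, PUB shape] +
(IMC≥∘BDP)ᵗ `hLA` [OPEN at `p ∥ N`] on the surjective pairs, (T2) upper half where `p ∣ ∏c_ℓ`, (T3)
X11a's lower half, (T4′) `Typed.MissingPPartAt` on `ClassX11b ∧ ¬Surj ∧ p ∈ {5,7} ∧ p ∣ ord_p Δ_min ∧
¬Ram`. Exactly `bsdp_of_classX11b_five_of_typedInputs_local` with `hL` replaced by (`hLC`, `hLA`)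
(`missingLowerBoundAt_of_classX11b_of_surj_of_onTreeInputs` for the lower half of the surjective
branch; the upper half and the corner verbatim). CONDITIONAL; nothing booked; X11b stays
CONSTRUCTION-SHAPED. [cite: JetchevSkinnerWan2017, §7.4.1–7.4.3 (pp. 30–31)]
[cite: Castella2018, Thm. 2.3 (p. 5), Thm. 3.2 (p. 9)] [cite: McCallumLMS1991, §1 Theorem (Kolyvagin), p. 296]
[cite: Skinner2016PacificMC, Thm. C (§1) and footnote 1] [cite: Wuthrich2014, Prop. 21 (p. 400)]
[cite: SilvermanATAEC1994, V.6 Prop. 6.1 (p. 410)] [cite: BalakrishnanEtAl2019, §1 Thm. 1.2 (arXiv:1711.05846 p. 2)]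
[cite: Miller2011LMS, Def. 1.1] -/
theorem bsdp_of_classX11b_five_of_onTreeInputs_local
    -- published inputs (named facts of the tree)
    (hGZ : ∀ (N : ℕ) [NeZero N] (W : WeierstrassCurve ℚ) (K : Type) [Field K] [NumberField K],
      gross_zagier N W K)
    (hKo : ∀ (N : ℕ) [NeZero N] (W : WeierstrassCurve ℚ) (K : Type) [Field K] [NumberField K],
      kolyvagin N W K)
    (hB : ∀ (N : ℕ) [NeZero N] (W : WeierstrassCurve ℚ) (K : Type) [Field K] [NumberField K],
      Kolyvagin1990_padicValNat_card_sha_le N W K)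
    (hSk : Skinner2016.thmC_padicValRat_bsd_rank_zero) (hWu : sha_dvd_analyticSha)
    (hGZK : rank_eq_analyticRank_of_analyticRank_le_one) (hmod : hasEntireLFunction_rat)
    (hnf : exists_isNewformOf) (hHL : HoffsteinLuo1997_exists_twist_L_one_ne_zero)
    (hFHs : friedbergHoffstein_exists_heegnerField_split_twist_ne_zero)
    (hMaz : mazur_not_dvd_maninConstant_of_odd) (hNS : integral_neronScaling_of_isGloballyMinimal)
    (hBDMTV : thm12_not_le_normalizer_splitCartan)
    -- (T1ᵗ-CTL) the control link on the constructed `X_ac` — PUB shape (Cas18 Thm. 2.3)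
    (hLC : ∀ (W : WeierstrassCurve ℚ) [W.IsElliptic] [W.IsGloballyMinimal] (p : ℕ) [Fact p.Prime]
      (N : ℕ) [NeZero N] (K : Type) [Field K] [NumberField K]
      (Dt : ModularParametrizationData W N) (H : HeegnerDatum N (NumberField.discr K)) (ι : K →+* ℂ)
      (P : (W.baseChange K).toAffine.Point),
      ClassX11b W p → 5 ≤ p → Surj W p → W.conductorNorm ℤ = N → IsImaginaryQuadratic K →
      Odd (NumberField.discr K) → ¬ (p : ℤ) ∣ NumberField.discr K → ¬ p ∣ Units.torsionOrder K →
      SatisfiesHeegnerHypothesis N K →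
      (W.quadraticTwist (NumberField.discr K : ℚ)).entireLFunction 1 ≠ 0 →
      WeierstrassCurve.Affine.Point.map ι.toRatAlgHom P = heegnerPointComplex Dt H →
      ¬ (p : ℤ) ∣ Dt.c → ¬ IsOfFinAddOrder P →
      ∀ (κ : ZpExtension K p), κ.IsAnticyclotomic →
        ∀ (γ : Field.absoluteGaloisGroup K) [Fact (κ.IsTopGenerator γ)]
          (𝔭 : HeightOneSpectrum (𝓞 K)) (h𝔭 : ((p : ℕ) : 𝓞 K) ∈ 𝔭.asIdeal)
          (he : 𝔭.asIdeal.ramificationIdx (𝓞 ℚ) = 1) (hf : 𝔭.asIdeal.inertiaDeg (𝓞 ℚ) = 1),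
          ControlOnTreeAt p κ 𝔭 γ (embAt K p 𝔭 h𝔭 he hf) P)
    -- (T1ᵗ-IMC) the one-sided main-conjecture link composed with BDP, on constructed objects — OPEN
    (hLA : ∀ (W : WeierstrassCurve ℚ) [W.IsElliptic] [W.IsGloballyMinimal] (p : ℕ) [Fact p.Prime]
      (N : ℕ) [NeZero N] (K : Type) [Field K] [NumberField K]
      (Dt : ModularParametrizationData W N) (H : HeegnerDatum N (NumberField.discr K)) (ι : K →+* ℂ)
      (P : (W.baseChange K).toAffine.Point),
      ClassX11b W p → 5 ≤ p → Surj W p → W.conductorNorm ℤ = N → IsImaginaryQuadratic K →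
      Odd (NumberField.discr K) → ¬ (p : ℤ) ∣ NumberField.discr K → ¬ p ∣ Units.torsionOrder K →
      SatisfiesHeegnerHypothesis N K →
      (W.quadraticTwist (NumberField.discr K : ℚ)).entireLFunction 1 ≠ 0 →
      WeierstrassCurve.Affine.Point.map ι.toRatAlgHom P = heegnerPointComplex Dt H →
      ¬ (p : ℤ) ∣ Dt.c → ¬ IsOfFinAddOrder P →
      ∀ (κ : ZpExtension K p), κ.IsAnticyclotomic →
        ∀ (γ : Field.absoluteGaloisGroup K) [Fact (κ.IsTopGenerator γ)]
          (𝔭 : HeightOneSpectrum (𝓞 K)) (h𝔭 : ((p : ℕ) : 𝓞 K) ∈ 𝔭.asIdeal)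
          (he : 𝔭.asIdeal.ramificationIdx (𝓞 ℚ) = 1) (hf : 𝔭.asIdeal.inertiaDeg (𝓞 ℚ) = 1),
          IMCLowerWaldspurgerOnTreeAt p κ 𝔭 γ (embAt K p 𝔭 h𝔭 he hf) P)
    -- (T2) the Euler-system half where `p ∣ ∏ c_ℓ`
    (hU : ∀ (W : WeierstrassCurve ℚ) [W.IsElliptic] [W.IsGloballyMinimal] (p : ℕ) [Fact p.Prime],
      ClassX11b W p → 5 ≤ p → p ∣ W.tamagawaProduct → Typed.MissingUpperBoundAt W p)
    -- (T3) the main-conjecture half on the rank-0 sister class X11a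
    (hX11a : ∀ (Wd : WeierstrassCurve ℚ) [Wd.IsElliptic] [Wd.IsGloballyMinimal] (p : ℕ)
      [Fact p.Prime], ClassX11a Wd p → Typed.MissingLowerBoundAt Wd p)
    -- (T4′) the non-surjective corner, LOCALISED: `p ∈ {5,7}`, `p ∣ ord_p Δ_min`, no (ram) prime
    (hC : ∀ (W : WeierstrassCurve ℚ) [W.IsElliptic] [W.IsGloballyMinimal] (p : ℕ) [Fact p.Prime],
      ClassX11b W p → ¬ Surj W p → (p = 5 ∨ p = 7) →
        p ∣ padicValInt p W.minimalDiscriminantInt → ¬ Ram W p → Typed.MissingPPartAt W p) :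
    ∀ (W : WeierstrassCurve ℚ) [W.IsElliptic] [W.IsGloballyMinimal] (p : ℕ) [Fact p.Prime],
      ClassX11b W p → 5 ≤ p → BSDp W p := by
  intro W _ _ p _ hX hp5
  by_cases hs : Surj W p
  · refine Typed.bsdp_of_missingPPartAt W p hGZK (by rw [hX.1]) ?_
    refine Typed.missingPPartAt_of_lower_of_upper W p
      (missingLowerBoundAt_of_classX11b_of_surj_of_onTreeInputs hGZ hKo hWu hGZK hmod hnf hHL hMaz
        hNS hLC hLA W p hX hp5 hs) ?_
    by_cases ht : p ∣ W.tamagawaProduct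
    · exact hU W p hX hp5 ht
    by_cases hram : Ram W p
    · exact missingUpperBoundAt_of_classX11b_of_ram_of_not_dvd hGZ hKo hB hSk hGZK hmod hnf hHL hMaz
        hNS W p hX hram ht
    · exact missingUpperBoundAt_of_classX11b_of_not_ram_of_lowerX11a hGZ hKo hB hGZK hmod hnf hFHs
        hMaz hNS W p hX hp5 hram hs ht (fun Wd _ _ hXa ↦ hX11a Wd p hXa)
  · obtain ⟨h57, hdvd, hnr⟩ := ClassX11b.not_surj_shape W p hBDMTV hX hp5 hs
    exact Typed.bsdp_of_missingPPartAt W p hGZK (by rw [hX.1]) (hC W p hX hs h57 hdvd hnr)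

end Summit.BirchSwinnertonDyer.Rank1Residual.X11b

end
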